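/- Copyright: the b2b-balaban cell (near-miss cell 7), T⁴-continuum fan-out; row NE7b CRUX team (2), seat
t4-ne7b-formalise-leaf-05 (gen 32) — the row OWNER's SPEC IR-46-2 «THE (α) ASSEMBLY» v0 l.15 «… leaf-05 toy» (owner gen 47
close, `CLAIMS.log` l.32260; custodian leaf-03 gen 26's FILE 1 p279430 ∕ FILE 2 p281050; my booking l.32351), part 2 of 2.
Released under the licence of the surrounding project. -/
import Summits.QuantumFields.BalabanUV.T4Continuum.Support.HistoryRealiseCellsRunAssemblyWTVS
import Summits.QuantumFields.BalabanUV.T4Continuum.Support.HistoryRealiseCellsRunAssemblyWTVSSanity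

/-!
# Sanity for the (α) assembly, part 2: RUN B AND THE S-ROWS ON THE TOY, THE INPUT RECORD `HistReadData` INHABITED ON THE
TOY READING, AND FILE 2's END `nonempty_countRoadWitnessT3bWTVS_of_histReading` READ BY NAME ON IT (companion of
`HistoryRealiseCellsRunAssemblyWTVSData` ∕ `HistoryRealiseCellsRunAssemblyWTVS`; SPEC IR-46-2 v0 «leaf-05 toy», lineage
`t4-ne7b-formalise-leaf-05` gen 32)

Summits-side support leaf of the T⁴-continuum cell (rung (B)+1 on a FINITE torus only; NOT infinite volume, NOT the
mass gap, NOT Clay; NOT a proof of NE7b — the cell's OWN estimate, NOT PRINTED, NOT PROVED).  [folklore] bookkeeping over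
part 1's toy (`ℛ₃`, `Φ₃`, `toyR`, `sum_term_toyR`, `weight_toyR`), ONE kernel definition (`ZD`, the datum's dressed
generating function — the left-hand side of FILE 1's H2 display, named), one record construction and one application BY
NAME; nothing printed asserted, no `def … : Prop` fact, no cite-tagged hypothesis, zero `sorry`.

§3 RUN B ON THE TOY: the truncation `trunc₃ K τ′ := ⟨K, τ′.2⟩` with its `MapsTo` (`trunc₃_mem` = `htr`); its fibre over a
run-A term is ONE POINT (`eq_lift₃_of_trunc₃`), so **`weightB_toy : weightB μ₀ R trunc₃ K t = weight μ₀ (R (K+1)) t`** term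
by term for ANY cutoff-indexed operations `R`; hence on the toy expansions `toyR (Z K t)`: `A K t τ = Z K t ∕ 6`,
`A′ K t τ = Z (K+1) t ∕ 6` (`weightB_toyR`) — the two runs' weights differ by the ratio of their generating functions, as
they must; NE7c's socket holds with ZERO shells (`shell_toyR`), and NE7's `ReindexedBudget` holds with class constant
`ν K`, zero radii and zero rates EXACTLY WHEN the two generating functions differ by a `t`-free factor `e^{ν K}` on the
source disc (`budget_toyR (hν)` — the displayed two-run input; on a general datum this IS the row's content, on the
cell's toy datum it is decided, part 3).
§4 **`ZD D g₀ os K t`** := `∫ e^{t·prodObs (D.scheme g₀) K os}·D.dens K (g₀ K) 0 dfieldMeasure` (FILE 1's H2 left-hand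
side), `ZD_pos` (from `T4StabilitySocket.exists_const_dressedZ` + `T4GenFunBounds.dressedZ_pos`, given `D.AvgMeasurable`);
**`histReadData₃`** : `HistReadData D C₂ O₁ θᵥ rr 1 n hn g₀ os Isk Isk _ μ₀ _ _ μ₀ _` with `RA K t := toyR (ZD D g₀ os K t)`
— so **H2A, H2B, «(1.72) holds» and integrability are DISCHARGED FOR EVERY DATUM** (`sum_term_toyR` + `integral_dirac`),
together with every reading-level field (part 1: (c1)'s `hL`∕`hs` by `rfl`, the flow's K-facts `hL4`∕`hprof`∕`hdrop`,
`HistRead`, the pass-V input conditions, constants, calibration, `FactorRead`, `RoundingRoomF` ×2, (2.9), `huV`,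
(ρ)∕(ρ′)∕«TRUNC» (vacuous), `hDJ`∕`hBB` (vacuous), `htr`, envelopes with `BA∞ := log (Zi∕6)`), from EXACTLY these
displayed inputs: `hM : D.AvgMeasurable` (K∕C: measurable averagings), **`hZ : ∀ K t, |t| ≤ 1 → ZD D g₀ os K t ≤ Zi`**
(R: the K-UNIFORM envelope of the dressed generating function on the source disc — the content of FILE 1's `BA∞`), flow
`isRj` ((2.5) at the constant sizes `F.L`), the (γ) floors and site budgets, and the S-rows (`shell`, `budget`, rates) as
PARAMETERS; **`nonempty_countRoadWitnessT3bWTVS_toy`**: FILE 2's END on `histReadData₃` with `shell := shell_toyR` —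
`Nonempty (CountRoadWitnessT3bWTVS D C₂ O₁ θᵥ rr 1 n hn g₀ os (HIndex.Idx Isk) (ℕ × Lab 1) (Lab 1))` from
`hM hZ isRj floor floor′ sites sites′` + the NE7 budget socket.  LOCATED: on the no-region reading the record's
H2∕(1.72)∕integrability displays carry NO constraint beyond `ZD > 0` — the datum enters ONLY through (2.5), the envelope
`hZ`, (γ)∕sites and the S-rows; part 3 (`…SanityToyData`) discharges all of them on the cell's toy datum.

R-OWNER-48-1 «THE GUARDED CUT» (`CLAIMS.log` l.32451).  `HistReadData` is uninhabitable AS TYPED for readings WITH a live join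
(unguarded `hDJ`) and is superseded FOR INHABITATION by `HistReadDataL` ∕ `…AssemblyWTVSL` (L4∕L5) when they land; THIS
inhabitant has NO live name (`hDJ`∕`hBB` vacuous) — it exercises FILE 1∕FILE 2 as landed and claims nothing about readings
with joins; its L-twin is the same term with two field assignments deleted and `hreg := regionsInBox_run₃`.

HONEST.  Proves nothing of Bałaban's; `hZ`, `isRj`, (γ)∕sites, `budget` are NOT claimed for a given datum; every R∕S field
of `HistReadData` stays a HYPOTHESIS of the assembly; BY-NAME EFFECT ON THE WALL: NONE; headline p224237 ∕ END v3.1′ ∕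
W∕V∕VS headlines UNCHANGED; NE7b NOT proved; spine 0∕9.  HONEST DEPENDENCY (cell): continuum YM on T⁴ ⇐ BetaPertH ∧ nine
spine estimates (0/9 proved); BetaPertH ⇐ (D1) ∧ (D4) ∧ CAP+tail; G-an2-4 gates asym, D1 and NE2/3/4.  Unchanged here.
-/


open Finset MeasureTheory
open Literature.MathematicalPhysics.QuantumFieldTheory.Balaban1983to89
open Literature.MathematicalPhysics.QuantumFieldTheory.Balaban1983to89.B16SProfile (DropCtl)
open T4PersistenceDictionary T4PersistentHistoryCount T4BankedInduction T4PrintedShapeBanking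
open T4WeightBudget T4GlobalDenominator T4LiveClassFibration T4LiveStructureGas T4LiveGasToTerms T4RecordPriceSeam
open T4PartnerMultiplicity T4IndicatorShell T4MatchingAssembly T4MatchingClosure T4MatchingClosureSocket T4Continuum
open T4StabilitySocket T4BranchingRecordsGas T4TaggedShapeBanking T4CanonicalMenus T4RenewalChains
open Summit.QuantumFields.BalabanUV.T4Continuum.HistoryFlow Summit.QuantumFields.BalabanUV.T4Continuum.HistoryGen
open Summit.QuantumFields.BalabanUV.T4Continuum.HistoryAdmissible
open Summit.QuantumFields.BalabanUV.T4Continuum.HistoryGenealogyExtraction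
open Summit.QuantumFields.BalabanUV.T4Continuum.HistoryGenealogyRealise
open Summit.QuantumFields.BalabanUV.T4Continuum.HistoryGenealogyInstantiate
open Summit.QuantumFields.BalabanUV.T4Continuum.HistoryGenealogyPedigree
open Summit.QuantumFields.BalabanUV.T4Continuum.HistoryAssemblyPedigree Summit.QuantumFields.BalabanUV.T4Continuum.HistoryAssemblyTerms
open Summit.QuantumFields.BalabanUV.T4Continuum.HistoryAssemblyMult Summit.QuantumFields.BalabanUV.T4Continuum.HistoryAssemblyMultKey
open Summit.QuantumFields.BalabanUV.T4Continuum.HistoryAssemblyRealiseRun Summit.QuantumFields.BalabanUV.T4Continuum.HistorySocketTH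
open Summit.QuantumFields.BalabanUV.T4Continuum.HistoryRealiseDistinct
open Summit.QuantumFields.BalabanUV.T4Continuum.HistoryRealiseCellsRunApexT3bWTVS
open Summit.QuantumFields.BalabanUV.T4Continuum.B16HistoryIndexedRepr
open Summit.QuantumFields.BalabanUV.T4Continuum.B16HistoryIndexedTrunc
open Summit.QuantumFields.BalabanUV.T4Continuum.HistoryBankingLE Summit.QuantumFields.BalabanUV.T4Continuum.HistoryBankingVolumePlug
open Summit.QuantumFields.BalabanUV.T4Continuum.HistoryConstants Summit.QuantumFields.BalabanUV.T4Continuum.HistoryBankingDiscountCharge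
open Summit.QuantumFields.BalabanUV.T4Continuum.HistoryBankingCreditRead Summit.QuantumFields.BalabanUV.T4Continuum.HistoryBankingFibreRoom
open Summit.QuantumFields.BalabanUV.T4Continuum.HistoryPriceNodeSum Summit.QuantumFields.BalabanUV.T4Continuum.HistoryPriceKeys
open Summit.QuantumFields.BalabanUV.T4Continuum.HistoryRealiseCellsRunSupplyWTVS
open Summit.QuantumFields.BalabanUV.T4Continuum.HistoryRealiseCellsRunSupplyKeysWTVS
open Summit.QuantumFields.BalabanUV.T4Continuum.HistoryRealiseCellsRunSupplyWTVSSanity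
open Summit.QuantumFields.BalabanUV.T4Continuum.HistoryRealiseCellsRunSupplyKeysWTVSSanity
open Summit.QuantumFields.BalabanUV.T4Continuum.HistoryRealiseCellsRunAssemblyWTVSData
open Summit.QuantumFields.BalabanUV.T4Continuum.HistoryRealiseCellsRunAssemblyWTVS

namespace Summit.QuantumFields.BalabanUV.T4Continuum.HistoryRealiseCellsRunAssemblyWTVSSanity

noncomputable section

open B16HistoryIndexedRepr.Sanity B16HistoryIndexedRepr.SanityInput HistoryConstants.Sanity HistoryBankingCreditRead.Sanity
open HistoryBankingFibreRoom.Sanity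

-- the structural `DecidableEq` instance of the concrete tag type exceeds the default synthesis size (as in the siblings)
set_option synthInstance.maxSize 1024

/-! ## §3 Run B on the toy: the one-point truncation fibre, `A′` vs `A`, and the S-rows -/

/-- **THE TOY TRUNCATION**: a level-`(K+1)` term keeps its summand and history choice and is re-tagged `K` (the
skeleton is the same at every cutoff). [folklore] -/
def trunc₃ (K : ℕ) (τ' : HIndex.Idx Isk) : HIndex.Idx Isk := ⟨K, τ'.2⟩

/-- it maps run B's term set into run A's (`htr`) [folklore] -/
theorem trunc₃_mem (K : ℕ) : ∀ τ' ∈ HIndex.termSet Isk (K + 1), trunc₃ K τ' ∈ HIndex.termSet Isk K := by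
  intro τ' hτ'
  obtain ⟨p, hp, rfl⟩ := Finset.mem_map.1 hτ'
  exact Finset.mem_map.2 ⟨p, hp, rfl⟩

/-- the re-tagged copy one level up [folklore] -/
def lift₃ (τ : HIndex.Idx Isk) : HIndex.Idx Isk := ⟨τ.1 + 1, τ.2⟩

/-- truncating the lifted copy of a run-A term returns the term [folklore] -/
theorem trunc₃_lift₃ {K : ℕ} {τ : HIndex.Idx Isk} (hτ : τ ∈ HIndex.termSet Isk K) : trunc₃ K (lift₃ τ) = τ := by
  obtain ⟨K', q⟩ := τ
  have hK' : K' = K := HIndex.fst_eq_of_mem_termSet Isk hτ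
  subst hK'
  rfl

/-- the lifted copy of a run-A term is a run-B term [folklore] -/
theorem lift₃_mem {K : ℕ} {τ : HIndex.Idx Isk} (hτ : τ ∈ HIndex.termSet Isk K) : lift₃ τ ∈ HIndex.termSet Isk (K + 1) := by
  obtain ⟨q, hq, rfl⟩ := Finset.mem_map.1 hτ
  exact Finset.mem_map.2 ⟨q, hq, rfl⟩

/-- **THE TRUNCATION FIBRE OF A RUN-A TERM IS ONE POINT**: its lifted copy. [folklore] -/
theorem eq_lift₃_of_trunc₃ {K : ℕ} {τ τ' : HIndex.Idx Isk} (h1 : τ' ∈ HIndex.termSet Isk (K + 1))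
    (h2 : trunc₃ K τ' = τ) : τ' = lift₃ τ := by
  subst h2
  obtain ⟨K', q⟩ := τ'
  have hK' : K' = K + 1 := HIndex.fst_eq_of_mem_termSet Isk h1
  subst hK'
  rfl

/-- **RUN B AGGREGATED ON RUN A's INDEX IS RUN B READ AT THE LIFTED TERM**: for ANY cutoff-indexed operations over the
toy skeleton, `weightB μ₀ R trunc₃ K t τ` is the weight of `τ`'s copy under run `K + 1`'s operations (the fibre sum has
one term; same Dirac mass at every cutoff). [folklore] -/
theorem weightB_toy (R : (K : ℕ) → ℝ → Repr172R (GoodClass.top Unit) (Isk K)) (K : ℕ) (t : ℝ) {τ : HIndex.Idx Isk}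
    (hτ : τ ∈ HIndex.termSet Isk K) :
    weightB μ₀ R trunc₃ K t τ = Repr172R.weight μ₀ (fun _ => R (K + 1)) t τ := by
  have hmem : lift₃ τ ∈ (HIndex.termSet Isk (K + 1)).filter (fun τ' => trunc₃ K τ' = τ) :=
    Finset.mem_filter.2 ⟨lift₃_mem hτ, trunc₃_lift₃ hτ⟩
  have hzero : ∀ b ∈ (HIndex.termSet Isk (K + 1)).filter (fun τ' => trunc₃ K τ' = τ), b ≠ lift₃ τ →
      Repr172R.weight μ₀ R t b = 0 :=
    fun b hb hne => absurd (eq_lift₃_of_trunc₃ (Finset.mem_filter.1 hb).1 (Finset.mem_filter.1 hb).2) hne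
  rw [weightB_def, Finset.sum_eq_single_of_mem (lift₃ τ) hmem hzero]
  obtain ⟨K', a, ι⟩ := τ
  have hK' : K' = K := HIndex.fst_eq_of_mem_termSet Isk hτ
  subst hK'
  rfl

/-- **ON THE TOY EXPANSIONS: `A′ K t τ = Z (K+1) t ∕ 6`** against `A K t τ = Z K t ∕ 6` (`weight_toyR`) — the two runs'
term weights differ by the ratio of their generating functions. [folklore] -/
theorem weightB_toyR {Z : ℕ → ℝ → ℝ} {K : ℕ} {t : ℝ} (hz : 0 < Z (K + 1) t) {τ : HIndex.Idx Isk}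
    (hτ : τ ∈ HIndex.termSet Isk K) : weightB μ₀ (fun K t => toyR (Z K t)) trunc₃ K t τ = Z (K + 1) t / 6 := by
  rw [weightB_toy _ K t hτ]
  obtain ⟨K', a, ι⟩ := τ
  show ∫ x, (toyR (Z (K + 1) t)).eterm a ι x ∂(Measure.dirac ()) = _
  rw [MeasureTheory.integral_dirac, eterm_toyR hz]

/-- **NE7c's SOCKET ON THE TOY WITH ZERO SHELLS** (shell parts `0 ≤ 0 ≤ A, A′`, totals `0 ≤ 0 · Σ`). [folklore] -/
theorem shell_toyR (Z : ℕ → ℝ → ℝ) :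
    ShellWeightBound 1 (HIndex.termSet Isk) (fun _ t => Repr172R.weight μ₀ (fun K t => toyR (Z K t)) t)
      (weightB μ₀ (fun K t => toyR (Z K t)) trunc₃) (fun _ _ _ => 0) (fun _ _ _ => 0) (fun _ => 0) where
  nonneg _ := le_rfl
  summable := summable_zero
  sh_nonneg_left _ _ _ _ _ := le_rfl
  sh_le_left _ t _ τ _ := weight_toyR_nonneg t τ
  sh_nonneg_right _ _ _ _ _ := le_rfl
  sh_le_right K t _ τ _ := weightB_nonneg μ₀ (fun K t => toyR (Z K t)) trunc₃ K t (fun _ _ _ => zero_le_one) τ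
  left _ _ _ := by simp
  right _ _ _ := by simp

/-- **NE7's SOCKET ON THE TOY, FROM THE DISPLAYED TWO-RUN INPUT**: if on the source disc the two runs' generating functions
differ by a `t`-FREE factor, `Z (K+1) t = e^{ν K} · Z K t` (on a general datum this is the row's content; on the cell's toy
datum with the empty string it is decided — part 3), then `ReindexedBudget` holds over ANY bad-class family with class
constant `ν K`, ZERO radii, ZERO recent constants and ZERO rates: the per-term sandwich is the identity
`e^{ν K}·A = A′`. [folklore] -/
theorem budget_toyR {Z : ℕ → ℝ → ℝ} (hpos : ∀ K t, |t| ≤ 1 → 0 < Z K t) (ν : ℕ → ℝ)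
    (hν : ∀ K t, |t| ≤ 1 → Z (K + 1) t = Real.exp (ν K) * Z K t) (Bad : ℕ → ℝ → Finset (HIndex.Idx Isk)) :
    ReindexedBudget 1 1 (HIndex.termSet Isk)
      (fun K t τ => Repr172R.weight μ₀ (fun K t => toyR (Z K t)) t τ - (fun _ _ _ => (0 : ℝ)) K t τ)
      (fun K t τ => weightB μ₀ (fun K t => toyR (Z K t)) trunc₃ K t τ - (fun _ _ _ => (0 : ℝ)) K t τ) Bad
      (fun K _ _ => ν K) (fun _ _ _ => 0) (fun _ _ _ => 0) (fun _ _ _ => 0)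
      ν (fun _ => 0) (fun _ => 0) (fun _ => 0) (fun _ => 0) (fun _ => 0) where
  nonneg _ t _ τ _ := by simpa using weight_toyR_nonneg t τ
  lower K t ht τ hτ := by
    have hτ' := (Finset.mem_sdiff.1 hτ).1
    obtain ⟨K', a, ι⟩ := τ
    have hK' : K' = K := HIndex.fst_eq_of_mem_termSet Isk hτ'
    subst hK'
    simp only [sub_zero]
    rw [weightB_toyR (hpos (K' + 1) t ht) hτ', weight_toyR (hpos K' t ht), hν K' t ht]
    ring_nf
    rfl
  upper K t ht τ hτ := by
    have hτ' := (Finset.mem_sdiff.1 hτ).1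
    obtain ⟨K', a, ι⟩ := τ
    have hK' : K' = K := HIndex.fst_eq_of_mem_termSet Isk hτ'
    subst hK'
    simp only [sub_zero, add_zero]
    rw [weightB_toyR (hpos (K' + 1) t ht) hτ', weight_toyR (hpos K' t ht), hν K' t ht]
    ring_nf
    rfl
  uv_const _ _ _ _ _ := by simp
  uv_radius _ _ _ _ _ := by simp
  recent_remainder _ _ _ _ _ := by simp
  recent_deviation _ _ _ _ _ := by simp

/-! ## §4 The datum's dressed generating function, the input record on the toy, and FILE 2's END read BY NAME -/

section Record

variable {F : T4Family} {G : Type*} [GaugeGroup G] [MeasurableSpace G] [HaarData G]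

/-- **THE DATUM's DRESSED GENERATING FUNCTION** of run `K` for the string `os` at source `t` (Bałaban's normalisation):
the left-hand side of FILE 1's H2 display, named. [folklore] -/
def ZD (D : FiniteEpsData F G) (g₀ : ℕ → ℝ) (os : List (ULoop F)) (K : ℕ) (t : ℝ) : ℝ :=
  ∫ U, Real.exp (t * T4GenFunBounds.prodObs (D.scheme g₀) K os U) * D.dens K (g₀ K) 0 U ∂fieldMeasure (F.P K) 0 G

variable [RegularGaugeGroup G]

/-- it is POSITIVE for every datum with measurable averagings (`exists_const_dressedZ`: `ρ₀ = c·e^{−A∕g₀²}`, `c > 0`;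
`dressedZ_pos` on the bounded measurable product observable). [folklore] -/
theorem ZD_pos (D : FiniteEpsData F G) (hM : D.AvgMeasurable) (g₀ : ℕ → ℝ) (os : List (ULoop F)) (K : ℕ) (t : ℝ) :
    0 < ZD D g₀ os K t := by
  obtain ⟨c, hc, -, h⟩ := exists_const_dressedZ D K (g₀ K)
  unfold ZD
  rw [h]
  exact mul_pos hc (T4GenFunBounds.dressedZ_pos (F.P K) (B := 1) (sq_nonneg _)
    (T4GenFunBounds.measurable_prodObs (D.scheme g₀) (fun K C => D.measurable_avgObs hM K C) K os)
    (T4GenFunBounds.abs_prodObs_le_one (D.scheme g₀) (fun K C U => D.abs_avgObs_le_one K C U) K os) t)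

/-- **THE (α) INPUT RECORD `HistReadData` INHABITED ON THE TOY READING**, run A's and run B's operations := the toy
(1.72)-expansions `toyR (ZD D g₀ os K t)` of the datum's OWN dressed generating functions (so H2A∕H2B∕«(1.72) holds»∕
integrability are discharged for every datum), every reading-level field discharged on `ℛ₃ F.L` ∕ `Φ₃` (part 1), from
EXACTLY: measurable averagings `hM`, the K-uniform envelope `hZ` of the generating function on the source disc, the flow
display `isRj`, the (γ) floors and site budgets, and the S-rows as PARAMETERS. [folklore] -/
def histReadData₃ (D : FiniteEpsData F G) (hM : D.AvgMeasurable) (θv : ℝ) (rr n : ℕ) (hn : 0 < n) (g₀ : ℕ → ℝ)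
    (os : List (ULoop F)) {Zi : ℝ} (hZ : ∀ K t, |t| ≤ 1 → ZD D g₀ os K t ≤ Zi)
    (isRj : ∀ K s, s ≤ K → B14.IsRj F.L rr ((D.C ⟨K, F.m, g₀ K⟩).flow.g s) F.L)
    {c₀ n₁ : ℝ} (c₀_pos : 0 < c₀) (floor : ∀ K, c₀ ≤ smallFieldMass D K (g₀ K))
    (floor' : ∀ K, c₀ ≤ smallFieldMass D (K + 1) (g₀ (K + 1)))
    (sites : ∀ K, ((D.C ⟨K, F.m, g₀ K⟩).numSites K : ℝ) ≤ n₁)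
    (sites' : ∀ K, ((D.C ⟨K + 1, F.m, g₀ (K + 1)⟩).numSites (K + 1) : ℝ) ≤ n₁)
    {shA shB : ℕ → ℝ → HIndex.Idx Isk → ℝ} {Wsh : ℕ → ℝ}
    (shell : ShellWeightBound 1 (HIndex.termSet Isk)
      (fun _ t => Repr172R.weight μ₀ (fun K t => toyR (ZD D g₀ os K t)) t)
      (weightB μ₀ (fun K t => toyR (ZD D g₀ os K t)) trunc₃) shA shB Wsh)
    {Cc Rr CcRec RrRec : ℕ → ℝ → HIndex.Idx Isk → ℝ} {ν u s₂ q₀ r s : ℕ → ℝ}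
    (budget : ReindexedBudget 1 1 (HIndex.termSet Isk)
      (fun K t τ => Repr172R.weight μ₀ (fun K t => toyR (ZD D g₀ os K t)) t τ - shA K t τ)
      (fun K t τ => weightB μ₀ (fun K t => toyR (ZD D g₀ os K t)) trunc₃ K t τ - shB K t τ)
      (badOfClass (bstrOf Prod.fst (memA n F.L (ℛ₃ F.L))) (HIndex.termSet Isk)
        (fun K _ => badClasses Prod.fst (memA n F.L (ℛ₃ F.L)) jhalf (HIndex.termSet Isk) K))
      Cc Rr CcRec RrRec ν u s₂ q₀ r s)
    (sum_r : Summable r) (sum_u : Summable u) (sum_s : Summable s) (sum_s₂ : Summable s₂) :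
    HistReadData D C₂ O₁ θv rr 1 n hn g₀ os Isk Isk (fun _ => Unit) μ₀ (fun _ => GoodClass.top Unit) (fun _ => Unit) μ₀
      (fun _ => GoodClass.top Unit) where
  l₀ := 1
  vol := 1
  l₀_pos := one_pos
  vol_pos := one_pos
  K₀ := 0
  RA K t := toyR (ZD D g₀ os K t)
  ρA K t V := ∑ a : (Isk K).Adm, (toyR (ZD D g₀ os K t)).term a V
  holdsA _ _ _ := rfl
  intA _ _ _ _ _ := Integrable.of_finite
  H2A K t _ _ := by
    show ZD D g₀ os K t = ∫ x, ∑ a : (Isk K).Adm, (toyR (ZD D g₀ os K t)).term a x ∂(Measure.dirac ())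
    rw [MeasureTheory.integral_dirac, sum_term_toyR (ZD_pos D hM g₀ os K t)]
  ℛ := ℛ₃ F.L
  hL := rfl
  hs := rfl
  Φf := Φ₃ F.L (fun K => (D.C ⟨K, F.m, g₀ K⟩).flow.g) (ZD D g₀ os)
  hR := histRead_toy₃ F.L _ (ZD D g₀ os)
  isRj := isRj
  one_le_R _ _ _ := le_trans (by norm_num) (two_le_L F)
  hL4 := HistoryRealiseCellsRunPinned.four_le_L F
  hprof K _ t _ := runProfile_succ_le_toy F.L K t
  hdrop K _ m := dropCtl_runProfile_toy F.L K m
  hN K _ τ _ := newOK_run₃ F.L K τ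
  hRm K _ τ _ := rm_le_run₃ (two_le_L F) K τ
  hRmS K _ τ _ := rmS_run₃ (two_le_L F) K τ
  hRm2 K _ τ _ := rm2_run₃ F.L K τ
  hD K _ τ _ := newDisjoint_run₃ F.L K τ
  hbox K _ τ _ := inBoxOK_run₃ F.L n K τ
  hn₁ := le_of_eq rfl
  hE₂ := by norm_num [C₂]
  hE₃ := le_of_eq rfl
  Lu _ := 1
  jl _ := 20
  hLu0 _ _ := one_pos
  hj1 _ _ := by norm_num
  hLu K _ := hLu_toy₃ F.L _ (ZD D g₀ os) K 20
  hsmall _ _ := by norm_num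
  huΦ K _ := huΦ_toy₃ F.L _ (ZD D g₀ os) K
  huE₂ K _ := huE₂_toy₃ F.L _ (ZD D g₀ os) K
  huE₃ K _ := huE₃_toy₃ F.L _ (ZD D g₀ os) K
  sB := sB₃ F.L (fun K => (D.C ⟨K, F.m, g₀ K⟩).flow.g)
  sR := sR₃ F.L (fun K => (D.C ⟨K, F.m, g₀ K⟩).flow.g)
  φB _ := φB₁
  φR _ := φR₁
  β' := 0
  β₀ := 0
  hF K _ := factorRead_toy F.L _ (ZD D g₀ os) K
  hRR K _ := roundingRoomF_toy₃ F.L (fun K => (D.C ⟨K, F.m, g₀ K⟩).flow.g) K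
  h29 K _ := flow29_const F.L (le_trans (by norm_num) (two_le_L F)) _ 0 K
  huV K _ τ hτ := absurd hτ (not_mem_badTerms₃ F.L _ jhalf K τ)
  W _ := 2
  one_le_W _ := one_le_two
  Wi := 2
  BAi := Real.log (Zi / 6)
  mi := 1
  hWi _ := le_rfl
  hBA K _ ht _ := BA_le_of_le F.L _ (fun K t _ => ZD_pos D hM g₀ os K t) hZ K ht
  hmi K := le_of_eq (by simp [μ₀])
  hρ K _ _ _ k hk := absurd hk (not_mem_badGMems₃ F.L _ _ jhalf K k)
  c₀ := c₀
  n₁ := n₁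
  c₀_pos := c₀_pos
  floor K _ := floor K
  floor' K _ := floor' K
  sites K _ := sites K
  sites' K _ := sites' K
  hDJ K _ τ _ c hc := absurd hc (not_mem_liveCV₃ F.L K τ c)
  hBB K _ τ _ c hc := absurd hc (not_mem_liveCV₃ F.L K τ c)
  RB K t := toyR (ZD D g₀ os K t)
  ρB K t V := ∑ a : (Isk (K + 1)).Adm, (toyR (ZD D g₀ os (K + 1) t)).term a V
  holdsB _ _ _ := rfl
  intB _ _ _ _ _ := Integrable.of_finite
  H2B K t _ _ := by
    show ZD D g₀ os (K + 1) t =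
      ∫ x, ∑ a : (Isk (K + 1)).Adm, (toyR (ZD D g₀ os (K + 1) t)).term a x ∂(Measure.dirac ())
    rw [MeasureTheory.integral_dirac, sum_term_toyR (ZD_pos D hM g₀ os (K + 1) t)]
  trunc := trunc₃
  htr K _ := trunc₃_mem K
  dB _ _ _ := 0
  mup _ _ := 0
  sB' := sB₃ F.L (fun K => (D.C ⟨K, F.m, g₀ K⟩).flow.g)
  φB' _ := φB₁
  sR' := sR₃ F.L (fun K => (D.C ⟨K, F.m, g₀ K⟩).flow.g)
  φR' _ := φR₁
  hRR' K _ := roundingRoomF_toy₃ F.L (fun K => (D.C ⟨K, F.m, g₀ K⟩).flow.g) K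
  upB K _ _ _ k hk := absurd hk (not_mem_badGMems₃ F.L _ _ jhalf K k)
  deadB_nonneg K _ _ _ k hk := absurd hk (not_mem_badGMems₃ F.L _ _ jhalf K k)
  resumB K _ _ _ k hk := absurd hk (not_mem_badGMems₃ F.L _ _ jhalf K k)
  mup_bd _ _ _ _ := ⟨le_rfl, by positivity⟩
  shA := shA
  shB := shB
  Wsh := Wsh
  shell := shell
  Cc := Cc
  Rr := Rr
  CcRec := CcRec
  RrRec := RrRec
  ν := ν
  u := u
  s₂ := s₂
  q₀ := q₀
  r := r
  s := s
  budget := budget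
  sum_r := sum_r
  sum_u := sum_u
  sum_s := sum_s
  sum_s₂ := sum_s₂

/-- **FILE 2's END READ BY NAME ON THE TOY RECORD** (shells := zero): from measurable averagings, the K-uniform
envelope `hZ`, (2.5) `isRj`, the (γ) floors ∕ site budgets and the NE7 budget socket ALONE; content nil by design (no
region ⇒ no bad class); NE7b NOT proved. [folklore] -/
theorem nonempty_countRoadWitnessT3bWTVS_toy (D : FiniteEpsData F G) (hM : D.AvgMeasurable) (θv : ℝ) (rr n : ℕ)
    (hn : 0 < n) (g₀ : ℕ → ℝ) (os : List (ULoop F)) {Zi : ℝ} (hZ : ∀ K t, |t| ≤ 1 → ZD D g₀ os K t ≤ Zi)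
    (isRj : ∀ K s, s ≤ K → B14.IsRj F.L rr ((D.C ⟨K, F.m, g₀ K⟩).flow.g s) F.L)
    {c₀ n₁ : ℝ} (c₀_pos : 0 < c₀) (floor : ∀ K, c₀ ≤ smallFieldMass D K (g₀ K))
    (floor' : ∀ K, c₀ ≤ smallFieldMass D (K + 1) (g₀ (K + 1)))
    (sites : ∀ K, ((D.C ⟨K, F.m, g₀ K⟩).numSites K : ℝ) ≤ n₁)
    (sites' : ∀ K, ((D.C ⟨K + 1, F.m, g₀ (K + 1)⟩).numSites (K + 1) : ℝ) ≤ n₁)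
    {Cc Rr CcRec RrRec : ℕ → ℝ → HIndex.Idx Isk → ℝ} {ν u s₂ q₀ r s : ℕ → ℝ}
    (budget : ReindexedBudget 1 1 (HIndex.termSet Isk)
      (fun K t τ => Repr172R.weight μ₀ (fun K t => toyR (ZD D g₀ os K t)) t τ - (fun _ _ _ => (0 : ℝ)) K t τ)
      (fun K t τ => weightB μ₀ (fun K t => toyR (ZD D g₀ os K t)) trunc₃ K t τ - (fun _ _ _ => (0 : ℝ)) K t τ)
      (badOfClass (bstrOf Prod.fst (memA n F.L (ℛ₃ F.L))) (HIndex.termSet Isk)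
        (fun K _ => badClasses Prod.fst (memA n F.L (ℛ₃ F.L)) jhalf (HIndex.termSet Isk) K))
      Cc Rr CcRec RrRec ν u s₂ q₀ r s)
    (sum_r : Summable r) (sum_u : Summable u) (sum_s : Summable s) (sum_s₂ : Summable s₂) :
    Nonempty (CountRoadWitnessT3bWTVS D C₂ O₁ θv rr 1 n hn g₀ os (HIndex.Idx Isk) (ℕ × Lab 1) (Lab 1)) :=
  nonempty_countRoadWitnessT3bWTVS_of_histReading
    (histReadData₃ D hM θv rr n hn g₀ os hZ isRj c₀_pos floor floor' sites sites' (shell_toyR _) budget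
      sum_r sum_u sum_s sum_s₂)

end Record

end

end Summit.QuantumFields.BalabanUV.T4Continuum.HistoryRealiseCellsRunAssemblyWTVSSanity
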